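import Summits.KontsevichZagierPeriods.KontsevichZagierPeriods.Theses.FurushoPentagon
import Summits.KontsevichZagierPeriods.KontsevichZagierPeriods.Theorems.ReducedPeriodRing.Negative.Certificates

/-!
# Crux triage r1-1 (gen 2) — two kernel-checked remarks for the lead of crux `ReducedPeriodRing`
(stmt-KontsevichZagierPeriods-3929)

§A  TYPING PITFALL for every transfer line (cards cartier-pullback…, cartier-localised…,
    kontsevich-coheap…, effective-end-monoid, effective-period-scheme…): the sections / inverse
    transfers they describe (`Φ′ : A_ℝ → P`, `δ : 𝒫̃⁺ → P ⊗ ℚ̄`, "Φ∘Ψ = ·⊗1") have ℚ-VECTOR-SPACE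
    sources (Ayoub's ring, Kontsevich's `𝒫̃⁺`, `𝒪(torsor)`, `𝒪(End-scheme)`).  Any ADDITIVE map from a
    ℚ-module to the free abelian group `KZ.FormalRep` is `0` (`addMonoidHom_eq_zero_of_module_rat`,
    the mechanism of the landed refutation `NoriTransfer.no_additive_transfer_section` of item 0190).
    So no skeleton stub may type such a section into `KZ.FormalRep`; it must land in the QUOTIENT
    `KZ.FormalPeriodRing = FormalRep ⧸ relations`, which is uniquely divisible
    (`ReducedPeriodRingNegative.isUnit_natCast_formalPeriodRing`, landed p70154), or be phrased as
    membership in `KZ.relations` (as the cards' `hker` hypotheses correctly are).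

§B  FAT SEMISIMPLE MONOID: the cdisprove's independence model `ℚ × ℚ[ε]`
    (`Disproof.piTorsion_model_not_reduced`) is the monoid algebra `ℚ[S]` of the commutative monoid
    `S = {1, g, e}` with `g² = ge = e² = e` (basis `u = (1,1)`, `g = (1,ε)`, `e = (1,0)`), i.e. the
    coordinate ring of the character scheme `Hom(S, (𝔸¹,·)) = Spec ℚ[a]/(a³ − a²)`, which is
    `End^⊗` of the SEMISIMPLE non-rigid tensor category of `S`-graded vector spaces.  Hence
    semisimplicity of an effective (non-rigid) tensor category does NOT make its `End^⊗`-monoid /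
    effective coend algebra reduced; what does is FULLNESS + subquotient-closure into a rigid
    envelope (sub-bialgebra of a Hopf algebra).  Bears on card effective-period-scheme…'s pure
    stratum ("pure Nori = André is semisimple, so … reduced" needs its (PF) hypothesis as
    load-bearing, not as decoration) and on card effective-end-monoid's engine (toy j005659).
-/

namespace CruxTriageG2

open Literature.NumberTheory.Transcendental

/-! ## §A -/

/-- Additive maps from a `ℚ`-module to the free abelian group `KZ.FormalRep` vanish. [folklore] -/
theorem addMonoidHom_eq_zero_of_module_rat {M : Type*} [AddCommGroup M] [Module ℚ M]
    (Φ : M →+ KZ.FormalRep) : Φ = 0 := by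
  -- additive maps from a `ℚ`-module to `ℤ` vanish
  have hint : ∀ h : M →+ ℤ, h = 0 := by
    intro h
    ext x
    set N : ℕ := (h x).natAbs + 1 with hN
    have hN0 : (N : ℚ) ≠ 0 := by positivity
    have hx : x = (N : ℤ) • ((N : ℚ)⁻¹ • x) := by
      rw [← Int.cast_smul_eq_zsmul ℚ, smul_smul]
      simp [hN0]
    have hdvd : (N : ℤ) ∣ h x := ⟨h ((N : ℚ)⁻¹ • x), by
      conv_lhs => rw [hx]
      rw [map_zsmul, smul_eq_mul]⟩
    have hlt : (h x).natAbs < (N : ℤ).natAbs := by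
      rw [Int.natAbs_natCast, hN]; exact Nat.lt_succ_self _
    simpa using Int.eq_zero_of_dvd_of_natAbs_lt_natAbs hdvd hlt
  ext x
  apply (FreeAbelianGroup.equivFinsupp _).injective
  rw [AddMonoidHom.zero_apply, map_zero]
  ext a
  have := hint
    ((Finsupp.applyAddHom a).comp ((FreeAbelianGroup.equivFinsupp _).toAddMonoidHom.comp Φ))
  simpa using DFunLike.congr_fun this x

/-- In particular a "section" of a transfer, typed from ANY commutative `ℚ`-algebra `A`
(`𝒪(torsor)`, `𝒪(End-scheme)`, Ayoub's `𝒪_alg(𝔻̄^∞)/⟨Stokes⟩`, Kontsevich's `𝒫̃⁺`) into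
`KZ.FormalRep`, is the zero map. [folklore] -/
theorem section_into_formalRep_eq_zero (A : Type*) [CommRing A] [Algebra ℚ A]
    (δ : A →+ KZ.FormalRep) : δ = 0 :=
  addMonoidHom_eq_zero_of_module_rat δ

/-- … whereas the quotient `P = KZ.FormalPeriodRing` is divisible (every `N ≥ 1` is a unit,
landed as `ReducedPeriodRingNegative.isUnit_natCast_formalPeriodRing`), so sections INTO `P`
are unobstructed. Recorded here only as the pointer. [folklore] -/
theorem formalPeriodRing_natCast_isUnit {N : ℕ} (hN : 0 < N) :
    IsUnit (N : KZ.FormalPeriodRing) :=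
  Summit.KontsevichZagierPeriods.KontsevichZagierPeriods.ReducedPeriodRingNegative.isUnit_natCast_formalPeriodRing hN

/-! ## §B -/

open DualNumber TrivSqZeroExt

/-- The model ring of `Disproof.piTorsion_model_not_reduced`. -/
abbrev R : Type := ℚ × DualNumber ℚ

/-- Basis `u = 1`, `g`, `e` of `R`, closed under multiplication: the monoid `S = {1, g, e}`. -/
def u : R := (1, 1)
/-- `g = (1, ε)`. -/
def g : R := (1, eps)
/-- `e = (1, 0)`, an idempotent. -/
def e : R := (1, 0)

theorem u_eq_one : u = 1 := rfl

theorem g_mul_g : g * g = e := by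
  ext <;> simp [g, e, eps_mul_eps]

theorem g_mul_e : g * e = e := by
  ext <;> simp [g, e]

theorem e_mul_e : e * e = e := by
  ext <;> simp [e]

/-- `S` is not separative: `g² = g e = e²` although `g ≠ e` — the monoid-theoretic source of the
nilpotent `g − e = (0, ε)`. -/
theorem not_separative : g * g = g * e ∧ g * e = e * e ∧ g ≠ e := by
  refine ⟨by rw [g_mul_g, g_mul_e], by rw [g_mul_e, e_mul_e], fun h => ?_⟩
  have := congrArg (fun p : R => snd p.2) h
  simp [g, e] at this

/-- `{u, g, e}` spans `R` … -/
theorem span_uge (x : R) : ∃ a b c : ℚ, x = a • u + b • g + c • e := by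
  refine ⟨fst x.2, snd x.2, x.1 - fst x.2 - snd x.2, ?_⟩
  ext <;> simp [u, g, e]

/-- … and is linearly independent, so `R ≅ ℚ[S]` is the monoid algebra of `S`. -/
theorem indep_uge (a b c : ℚ) (h : a • u + b • g + c • e = 0) : a = 0 ∧ b = 0 ∧ c = 0 := by
  have h1 := congrArg Prod.fst h
  have h2 := congrArg (fun p : R => fst p.2) h
  have h3 := congrArg (fun p : R => snd p.2) h
  simp [u, g, e] at h1 h2 h3
  refine ⟨h2, h3, ?_⟩
  linarith

/-- `g − e` is a non-zero element of square zero: the monoid algebra of the (finite, commutative,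
hence "semisimple-graded") monoid `S` is not reduced. -/
theorem sq_zero_witness : (g - e) ^ 2 = 0 ∧ g - e ≠ 0 := by
  refine ⟨by ext <;> simp [g, e, pow_two, eps_mul_eps], fun h => ?_⟩
  exact not_separative.2.2 (sub_eq_zero.mp h)

theorem not_isReduced_R : ¬ IsReduced R := by
  intro hR
  exact sq_zero_witness.2 (hR.eq_zero _ ⟨2, sq_zero_witness.1⟩)

end CruxTriageG2
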